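import Mathlib
import Summits.Ventures.PercRepro.TriangleCapBand
import Summits.Ventures.PercRepro.TriangleCapSevenElevenH

/-!
# PercRepro — THE CLOSED FORM OF THE `K₄⁻`-FREE CHERRY TABLE ON THE WHOLE DENSE CORNER (p3, gen 40; part 162)

**`closed_form_exact_k4m (k a r) (ha : 3 ≤ a) (hk : 2a + r ≤ k)`**: the maximum of `2·Σ_v C(d(v), 2)` over the
`K₄⁻`-free graphs on `Fin k` with `a (k − a) − r` edges is `(a (k − a) − r)(k − 2) − r (k − 1 − r)`, attained by
`K_{a, k−a}` minus `r` edges at one vertex — for EVERY row `a ≥ 3` and every distance `r` to the diagonal with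
`2a + r ≤ k`, i.e. on every cell `(k, m)` with `2k − 3 ≤ m ≤ ⌊k²/4⌋` (the rows tile the dense corner: the row
`a` spans `(a − 1)(k − a + 1) < m ≤ a (k − a)`, and `m ≥ 2k − 3` is the row `a ≥ 3`). The rows `r ≤ 4` are the
gens 34–40 cell theorems (parts 119, 121, 125, 126, 147), the row `a = 3` is part 153, the rows `a ≥ 4` are part
161; `products_avoid_gen` supplies the product hypotheses (`a (k − a) − r, …, a (k − a) − 1` are not products
`a′ (k − a′)` when `2a + r ≤ k`). Axioms: standard.
-/

namespace PercRepro

namespace TriangleCap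

namespace C047

open Finset

/-- **THE `r` NUMBERS BELOW `a (k − a)` ARE NOT PRODUCTS** when `2a + r ≤ k` (`1 ≤ r`). -/
theorem products_avoid_gen (k a r : ℕ) (ha : 1 ≤ a) (hr : 1 ≤ r) (hak : 2 * a + r ≤ k) :
    ∀ a', a' ≤ k → ∀ i, i + 1 ≤ r → a * (k - a) - r + i ≠ a' * (k - a') := by
  intro a' ha' i hi
  obtain ⟨a₁, rfl⟩ : ∃ a₁, a = a₁ + 1 := ⟨a - 1, by omega⟩
  obtain ⟨b, rfl⟩ : ∃ b, k = a₁ + 1 + (a₁ + 1 + r + b) := ⟨k - (2 * a₁ + 2 + r), by omega⟩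
  have hprod : (a₁ + 1) * (a₁ + 1 + (a₁ + 1 + r + b) - (a₁ + 1)) = (a₁ + 1) * (a₁ + 1 + r + b) := by
    congr 1; omega
  rw [hprod]
  have hX : r ≤ (a₁ + 1) * (a₁ + 1 + r + b) := by nlinarith
  by_cases hsmall : a' ≤ a₁ ∨ a₁ + 1 + (a₁ + 1 + r + b) ≤ a' + a₁
  · -- below the previous product `a₁ (k − a₁)`
    have h := prod_le_of_small a' (a₁ + 1 + (a₁ + 1 + r + b)) a₁ ha' (by omega) hsmall
    have e : a₁ + 1 + (a₁ + 1 + r + b) - a₁ = a₁ + 2 + r + b := by omega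
    rw [e] at h
    have : a₁ * (a₁ + 2 + r + b) + r + 1 ≤ (a₁ + 1) * (a₁ + 1 + r + b) := by ring_nf; omega
    omega
  · push Not at hsmall
    by_cases hmid : a₁ + 2 ≤ a' ∧ a' + (a₁ + 2) ≤ a₁ + 1 + (a₁ + 1 + r + b)
    · -- above the next product `(a₁ + 2)(k − a₁ − 2)`
      have h := prod_ge_of_between a' (a₁ + 1 + (a₁ + 1 + r + b)) (a₁ + 2) hmid.1 hmid.2
      have e : a₁ + 1 + (a₁ + 1 + r + b) - (a₁ + 2) = a₁ + r + b := by omega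
      rw [e] at h
      have : (a₁ + 1) * (a₁ + 1 + r + b) + r ≤ (a₁ + 2) * (a₁ + r + b) + 1 := by ring_nf; omega
      omega
    · -- `a′ = a` or `a′ = k − a`: the product itself
      push Not at hmid
      have hcases : a' = a₁ + 1 ∨ a' = a₁ + 1 + r + b := by omega
      rcases hcases with rfl | rfl
      · rw [hprod]; omega
      · have e : a₁ + 1 + (a₁ + 1 + r + b) - (a₁ + 1 + r + b) = a₁ + 1 := by omega
        have hprod2 : (a₁ + 1 + r + b) * (a₁ + 1 + (a₁ + 1 + r + b) - (a₁ + 1 + r + b)) =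
            (a₁ + 1) * (a₁ + 1 + r + b) := by
          rw [e, mul_comm]
        rw [hprod2]
        omega

/-- The density of the cells of the rows `a ≥ 3`: `a (k − a) ≥ 3 (k − 3)` for `3 ≤ a`, `a + 3 ≤ k`. -/
theorem three_mul_le_prod (k a : ℕ) (ha : 3 ≤ a) (hak : a + 3 ≤ k) : 3 * (k - 3) ≤ a * (k - a) :=
  prod_ge_of_between a k 3 ha hak

/-- **THE CLOSED FORM ON THE WHOLE DENSE CORNER:** for every row `a ≥ 3` and every `r` with `2a + r ≤ k`, the
maximum of `2·Σ_v C(d(v), 2)` over the `K₄⁻`-free graphs on `Fin k` with `a (k − a) − r` edges is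
`(a (k − a) − r)(k − 2) − r (k − 1 − r)`, attained by `K_{a, k−a}` minus `r` edges at one vertex. -/
theorem closed_form_exact_k4m (k a r : ℕ) (ha : 3 ≤ a) (hk : 2 * a + r ≤ k) :
    (∀ (D : SimpleGraph (Fin k)) [DecidableRel D.Adj], K4mFree D →
        D.edgeFinset.card = a * (k - a) - r →
        2 * cherries D + r * (k - 1 - r) ≤ (a * (k - a) - r) * (k - 2)) ∧
      ∃ (D : SimpleGraph (Fin k)) (_ : DecidableRel D.Adj), K4mFree D ∧
        D.edgeFinset.card = a * (k - a) - r ∧ 2 * cherries D + r * (k - 1 - r) = (a * (k - a) - r) * (k - 2) := by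
  have h3 := three_mul_le_prod k a ha (by omega)
  -- the products below `a (k − a)`: `a (k − a) − j` for `1 ≤ j ≤ r`
  have hprod : ∀ j, 1 ≤ j → j ≤ r → ∀ a', a' ≤ k → a * (k - a) - j ≠ a' * (k - a') := by
    intro j hj1 hjr a' ha'
    have := products_avoid_gen k a r (by omega) (by omega) hk a' ha' (r - j) (by omega)
    have e : a * (k - a) - r + (r - j) = a * (k - a) - j := by omega
    rwa [e] at this
  rcases Nat.lt_or_ge r 5 with h5 | h5
  · interval_cases r
    · -- the diagonal
      have h := diagonal_cells_exact k a (by omega) (by omega)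
      simp only [Nat.sub_zero, zero_mul, add_zero]
      exact h
    · -- one below
      have h := one_below_diagonal_exact_seven k a (by omega) (by omega) (by omega) (by omega)
        (fun a' ha' => hprod 1 (by norm_num) (by norm_num) a' ha')
      obtain ⟨h1, D, inst, hK, hD, hc⟩ := h
      obtain ⟨P, hP⟩ : ∃ P, a * (k - a) = P + 2 := ⟨a * (k - a) - 2, by omega⟩
      have e1 : P + 2 - 1 = P + 1 := by omega
      have e2 : P + 2 - 2 = P := by omega
      rw [hP] at h1 hD hc ⊢
      rw [e1] at h1 hD
      rw [e2] at h1 hc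
      rw [e1]
      obtain ⟨s, hs⟩ : ∃ s, k = s + 2 := ⟨k - 2, by omega⟩
      have e3 : k - 1 - 1 = s := by omega
      have e4 : k - 2 = s := by omega
      rw [e3, e4]
      rw [e4] at h1 hc
      refine ⟨fun D' _ hK' hD' => ?_, D, inst, hK, hD, by nlinarith [hc]⟩
      have := h1 D' hK' hD'
      nlinarith [this]
    · -- two below
      have h := two_below_diagonal_exact_k4m_of_eight k a (by omega) (by omega) (by omega) (by omega)
        (fun a' ha' => ⟨hprod 2 (by norm_num) (by norm_num) a' ha', hprod 1 (by norm_num) (by norm_num) a' ha'⟩)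
      have e : k - 1 - 2 = k - 3 := by omega
      rw [e]
      exact h
    · -- three below
      have h := three_below_diagonal_exact_k4m_of_nine k a (by omega) (by omega) (by omega) (by omega)
        (fun a' ha' => ⟨hprod 3 (by norm_num) (by norm_num) a' ha', hprod 2 (by norm_num) (by norm_num) a' ha',
          hprod 1 (by norm_num) (by norm_num) a' ha'⟩)
      have e : k - 1 - 3 = k - 4 := by omega
      rw [e]
      exact h
    · -- four below
      have h := four_below_diagonal_exact_k4m_all''' k a (by omega) ha hk
      have e : k - 1 - 4 = k - 5 := by omega
      rw [e]
      exact h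
  · rcases Nat.lt_or_ge a 4 with h4 | h4
    · have ha3 : a = 3 := by omega
      subst ha3
      exact three_band_exact_k4m k r (by omega) (by omega)
    · exact band_exact_k4m k a r h4 h5 hk

end C047

end TriangleCap

end PercRepro
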